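import Literature.Geometry.Lorentzian.KerrHyperboloidalFlux
import Literature.Geometry.Lorentzian.BoundedGeometry
import Literature.Geometry.Lorentzian.CoordDeformationWave
import HarnessLib

/-!
# Hyperboloidal Kerr-star charts, the LE-weighted leaf deviation and the local-energy size of the
stationarity defect `𝓛_{∂₀} g` (vocabulary file: definitions and their monotonicity only)

Statement-level vocabulary (T0) for late-time analysis of a vacuum spacetime in ONE
horizon-penetrating, asymptotically hyperboloidal chart modelled on a sub-extremal Kerr exterior,
in the integrated-decay language of Lindblad–Tohaneanu (arXiv:2004.05664, Thm. 1: the perturbation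
`h = g − g_K` is measured by `κ₁(t) = sup |∂^{≤1} h|` near the photon region with `κ₁ ∈ L²_t` and
by local-energy (LE) space-time norms with weights `⟨r⟩^{-1-δ}`, (1.6)–(1.8) ibid.) and of the
`r^p`/integrated-local-energy-decay method of Dafermos–Rodnianski–Shlapentokh-Rothman
(arXiv:1402.7034, §3.3: hyperboloidal leaves `Σ̃_τ` terminating at `𝓘⁺`). Nothing here is a
theorem of the literature; every declaration is a definition (or a monotonicity lemma about it),
to be used as hypothesis/conclusion vocabulary by route statements.

* `Kerr.hypStarBackground M a : ModelBackground` — the ingoing Kerr–Schild region `{r > M}`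
  (horizon-penetrating: `r₋ < M < r₊` for `0 < |a| < M`) with reference metric `g_{M,a}`
  (`Kerr.bilin`), HYPERBOLOIDAL time `τ = t* − h♯_{4M}(y)` (`Kerr.scriHeight`, the DRSR leaves:
  Kerr–Schild slices on `{r ≤ 4M}`, terminating at `𝓘⁺`) and Kerr–Schild radius.
* `ModelBackground.timeBand B I = {x ∈ U | t(x) ∈ I}` — space-time bands of chart time.
* `leWeight x = (1 + ‖y‖)⁻¹`, `leSupCkENorm S k f = sup_{m ≤ k} sup_{x ∈ S} (1+‖y‖)⁻¹ ‖D^m f(x)‖`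
  (the LE-weighted `Cᵏ` sup size) and `leSqDensity k f x = (1+‖y‖)⁻² Σ_{m ≤ k} ‖D^m f(x)‖²`
  (the LE-weighted square `Cᵏ` density; weight `⟨r⟩^{-2}`, i.e. `δ = 1` in LT20 (1.6)).
* `Spacetime.chartMetricDt 𝓢 B Ψ = ∂₀ (Ψ^* g)` — the coordinate time derivative of the chart
  metric, i.e. the components of the **stationarity defect** `𝓛_{∂₀} g` of the chart's time
  vector field (`(𝓛_ξ g)_{μν} = ξ^α ∂_α g_{μν} + …` reduces to `∂₀ g_{μν}` for `ξ = ∂₀`);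
  `Spacetime.timeCovector` — the covector `(∂₀)♭ = g(∂₀, ·)` in components;
  `Spacetime.IsWaveTimeOn 𝓢 B Ψ V` — the WAVE-TIME GAUGE `□_g (∂₀)♭ = 0` on `V`
  (`MetricCoord.tlap`), under which `π := 𝓛_{∂₀} g = deform (∂₀)♭` is an exact solution of the
  tensorial wave equation `□π = −2 Riem·π` in vacuum
  (`MetricCoord.IsMetricOn.tlap_deform_eq_of_tlap_eq_zero`, `CoordDeformationWave.lean`;
  Fischer–Marsden–Moncrief 1980, Lemma 2.2) — the chart's time vector is then an exact
  linearised (pure-gauge) perturbation generator, Killing iff `π = 0`.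
* `Spacetime.defectLE 𝓢 B Ψ k I Z = ∫_{timeBand I ∩ Z} (1+‖y‖)⁻² Σ_{m ≤ k} ‖D^m ∂₀(Ψ^*g)‖² dx`
  — the LE space-time size of the stationarity defect over the chart-time set `I` and the spatial
  zone `Z ⊆ E4` (Lebesgue integral on `E4`; in Kerr–Schild Cartesian coordinates
  `dVol_g = dt* dy`, `KerrHyperboloidalFlux.lean`).
* `Kerr.outerZones M₀ a₀ = {r(a₀,·) ≤ 2r₊ − M₀} ∪ {‖y‖ ≥ 8M₀}` — the near-horizon shell and the
  far zone of the chart (the complement, the "middle zone", contains the photon region).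
* `Spacetime.IsLeafRechart`, `Spacetime.leafDev 𝓢 M₀ a₀ Ψ χ k τ` — the **LE-weighted `Cᵏ` leaf
  deviation** of the unit band `Ψ({τ ≤ time ≤ τ+1})` from the sub-extremal Kerr family with spin
  margin `|a| ≤ χ M`: the infimum over masses, spins and RE-CHARTINGS `Φ` (smooth, injective on
  the measured set, covering the band outside `r(a₀,·) ≥ (r₊+M₀)/2`) of the weighted `Cᵏ` sup of
  `Φ^* g − g_{M,a}` over `Φ⁻¹(Ψ(band))` — a gauge-invariant functional of the space-time region
  (no regularity cap on `Φ`: near-isometries of bounded-geometry regions are as regular as the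
  metrics, Calabi–Hartman).
* `Spacetime.IsHypKerrFoliation 𝓢 k Λ χ M₀ a₀ τ₀ Ψ` — HYPOTHESIS structure: `Ψ` is a late chart
  on `hypStarBackground M₀ a₀` after `τ₀` whose chart metric is a genuine metric on the late
  region with `C^{k+4}` bounds `Λ` on unit bands and inverse bounded by `Λ` (Anderson 2004, §5),
  in wave-time gauge, future-oriented in the far zone, and whose deep shell
  `{r(a₀,·) ≤ (r₊+M₀)/2}` is causally invisible from the far zone (it lies inside the black hole).

Monotonicity lemmas (all proved): `leSupCkENorm_mono(_right)`, `leSqDensity_mono_right`,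
`defectLE_mono_time/zone/order`, `leafDev_mono_right`, `IsHypKerrFoliation.of_le`.
-/

open Set Filter MeasureTheory Function
open scoped Manifold ContDiff Topology ENNReal

universe u

noncomputable section

namespace Literature.Geometry.Lorentzian

/-! ### The hyperboloidal Kerr-star background -/

namespace Kerr

/-- The **hyperboloidal Kerr-star background** `B♯(M, a)`: domain the horizon-penetrating
Kerr–Schild region `Kerr.region a M = {r(a,·) > max M 0}` (for `0 < |a| < M` one has
`r₋ < M < r₊`, so the domain contains the event horizon and a collar inside it), reference metric
`g_{M,a}` in ingoing Kerr–Schild Cartesian components (`Kerr.bilin`), chart time the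
HYPERBOLOIDAL time `τ(x) = t*(x) − h♯_{4M}(y)` of the DRSR foliation terminating at `𝓘⁺`
(`Kerr.scriHeight M a (4M)`: the leaves `{τ = const}` are the Kerr–Schild slices on `{r ≤ 4M}`
and `{t = r + 2M log r + c}` far out), radius the Kerr–Schild `r`. Dafermos–Rodnianski–
Shlapentokh-Rothman arXiv:1402.7034, §3.3 and p. 51; DHRT arXiv:2104.08222, §1 (Kerr-star
charts `{t* ≥ τ₀}`). [cite: DafermosRodnianskiShlapentokhrothman2014, §3.3 and p. 51] -/
def hypStarBackground (M a : ℝ) : ModelBackground where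
  domain := region a M
  bilin := bilin M a
  time x := x 0 - scriHeight M a (4 * M) (E4.spatial x)
  radius := radius a

/-- The domain of `B♯(M,a)` is `Kerr.region a M`. [folklore] -/
@[simp]
theorem hypStarBackground_domain (M a : ℝ) : (hypStarBackground M a).domain = region a M := rfl

/-- The reference metric of `B♯(M,a)` is `g_{M,a}`. [folklore] -/
@[simp]
theorem hypStarBackground_bilin (M a : ℝ) : (hypStarBackground M a).bilin = bilin M a := rfl

/-- The chart time of `B♯(M,a)` is `t* − h♯_{4M}`. [folklore] -/
@[simp]
theorem hypStarBackground_time (M a : ℝ) (x : E4) :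
    (hypStarBackground M a).time x = x 0 - scriHeight M a (4 * M) (E4.spatial x) := rfl

/-- The radius of `B♯(M,a)` is the Kerr–Schild radius. [folklore] -/
@[simp]
theorem hypStarBackground_radius (M a : ℝ) : (hypStarBackground M a).radius = radius a := rfl

/-- The **outer zones** of the chart modelled on `B♯(M₀, a₀)`: the near-horizon shell
`{r(a₀,·) ≤ 2r₊ − M₀}` (adjacent to the inner edge `r = M₀` of the chart, straddling `r₊`) and the
far zone `{‖y‖ ≥ 8M₀}`; their complement is the "middle zone" containing the photon region.
Lindblad–Tohaneanu arXiv:2004.05664, §1 (the regions `r < r_ps^-`, `I_ps`, `r > r_ps^+`).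
[cite: LindbladTohaneanu2020, §1] -/
def outerZones (M₀ a₀ : ℝ) : Set E4 :=
  {x | radius a₀ x ≤ 2 * rPlus M₀ a₀ - M₀} ∪ {x | 8 * M₀ ≤ ‖E4.spatial x‖}

end Kerr

/-! ### Time bands -/

namespace ModelBackground

/-- The **time band** `{x ∈ U | t(x) ∈ I}` of a reference background over a set `I` of chart
times (`I = {τ}` is the slab `timeSlab`, `I = (τ₀, ∞)` the late region). DHRT arXiv:2104.08222,
§1. [cite: arXiv210408222, §1] -/
def timeBand (B : ModelBackground) (I : Set ℝ) : Set B.domain := {x | B.time x.1 ∈ I}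

/-- Membership in a time band. [folklore] -/
@[simp]
theorem mem_timeBand {B : ModelBackground} {I : Set ℝ} {x : B.domain} :
    x ∈ B.timeBand I ↔ B.time x.1 ∈ I := Iff.rfl

/-- Time bands are monotone in the time set. [folklore] -/
theorem timeBand_mono (B : ModelBackground) {I J : Set ℝ} (h : I ⊆ J) :
    B.timeBand I ⊆ B.timeBand J := fun _ hx ↦ h hx

/-- The late region is the time band over `(τ₀, ∞)`. [folklore] -/
theorem lateRegion_eq_timeBand (B : ModelBackground) (τ₀ : ℝ) :
    B.lateRegion τ₀ = B.timeBand (Ioi τ₀) := rfl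

end ModelBackground

/-! ### LE-weighted sup norms and square densities -/

section Weighted

variable {G : Type*} [NormedAddCommGroup G] [NormedSpace ℝ G]

/-- The **local-energy weight** `(1 + ‖y‖)⁻¹` at the space-time point `x = (x⁰, y)` (the weight
`⟨r⟩^{-(1+δ)/2}` of LT20 (1.6) with `δ = 1`, squared in `leSqDensity`).
[cite: LindbladTohaneanu2020, (1.6)] -/
def leWeight (x : E4) : ℝ≥0∞ := ENNReal.ofReal (1 + ‖E4.spatial x‖)⁻¹

/-- The **LE-weighted `Cᵏ` sup size** `sup_{m ≤ k} sup_{x ∈ S} (1+‖y‖)⁻¹ ‖D^m f(x)‖ ∈ [0, ∞]`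
(`supCkENorm` with the decaying weight, so that far-zone deviations of size `O(1)` at radius `R`
count `O(1/R)`). Lindblad–Tohaneanu arXiv:2004.05664, Thm. 1 (`κ₁ = sup |∂^{≤1} h|`) with the LE
weight of (1.6). [cite: LindbladTohaneanu2020, Thm. 1 and (1.6)] -/
def leSupCkENorm (S : Set E4) (k : ℕ) (f : E4 → G) : ℝ≥0∞ :=
  ⨆ (m : ℕ) (_ : m ≤ k), ⨆ x ∈ S, leWeight x * ‖iteratedFDeriv ℝ m f x‖ₑ

/-- The **LE-weighted square `Cᵏ` density** `(1+‖y‖)⁻² Σ_{m ≤ k} ‖D^m f(x)‖²` (integrand of the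
local-energy space-time norms `‖·‖_{LE}` of LT20 (1.6)–(1.8), `δ = 1`, at differentiability
order `k`). [cite: LindbladTohaneanu2020, (1.6)–(1.8)] -/
def leSqDensity (k : ℕ) (f : E4 → G) (x : E4) : ℝ≥0∞ :=
  leWeight x ^ 2 * ∑ m ∈ Finset.range (k + 1), ‖iteratedFDeriv ℝ m f x‖ₑ ^ 2

/-- The weighted sup size of the zero function vanishes. [folklore] -/
@[simp]
theorem leSupCkENorm_zero (S : Set E4) (k : ℕ) :
    leSupCkENorm S k (0 : E4 → G) = 0 := by
  simp [leSupCkENorm, enorm_eq_nnnorm]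

/-- The weighted sup size is monotone in the set. [folklore] -/
theorem leSupCkENorm_mono {S T : Set E4} (h : S ⊆ T) (k : ℕ) (f : E4 → G) :
    leSupCkENorm S k f ≤ leSupCkENorm T k f :=
  iSup₂_mono fun _ _ ↦ iSup_mono fun _ ↦ iSup_mono' fun hx ↦ ⟨h hx, le_rfl⟩

/-- The weighted sup size is monotone in the order. [folklore] -/
theorem leSupCkENorm_mono_right (S : Set E4) {k k' : ℕ} (h : k ≤ k') (f : E4 → G) :
    leSupCkENorm S k f ≤ leSupCkENorm S k' f :=
  iSup_mono fun _ ↦ iSup_mono' fun hm ↦ ⟨hm.trans h, le_rfl⟩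

/-- The weighted square density is monotone in the order. [folklore] -/
theorem leSqDensity_mono_right {k k' : ℕ} (h : k ≤ k') (f : E4 → G) (x : E4) :
    leSqDensity k f x ≤ leSqDensity k' f x := by
  have : Finset.range (k + 1) ⊆ Finset.range (k' + 1) := Finset.range_mono (by omega)
  unfold leSqDensity
  gcongr

end Weighted

/-! ### The stationarity defect of a chart and its LE size -/

namespace Spacetime

variable (𝓢 : Spacetime.{u} 4) (B : ModelBackground)

/-- The **coordinate time derivative of the chart metric**, `∂₀(Ψ^* g)(x)`: the components of
the stationarity defect `𝓛_{∂₀} g` of the chart's time vector field `∂₀ = Ψ_* e₀`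
(`(𝓛_{∂₀} g)_{μν} = ∂₀ g_{μν}` in the chart; derivative of the zero extension
`chartMetricExtend`, honest on the open chart domain). Fischer–Marsden–Moncrief 1980, §2
(`h = 𝓛_X g`); Anderson 2004, §5, (5.6). [cite: FischerMarsdenMoncrief1980, §2] -/
def chartMetricDt (Ψ : B.domain → 𝓢.carrier) : E4 → E4 →L[ℝ] E4 →L[ℝ] ℝ :=
  fun x ↦ fderiv ℝ (𝓢.chartMetricExtend B Ψ) x (E4.basisVector 0)

/-- The **time covector** `(∂₀)♭ = g(∂₀, ·)` of the chart in components,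
`T_m(x) = (Ψ^* g)(x)(e₀, e_m)`, as a covariant `1`-tensor in the format of `MetricCoord`
(index type `Unit → Fin 4`). O'Neill 1983, Ch. 3, p. 60. [cite: ONeill1983, Ch. 3, p. 60] -/
def timeCovector (Ψ : B.domain → 𝓢.carrier) : E4 → (Unit → Fin 4) → ℝ :=
  fun x I ↦ 𝓢.chartMetricExtend B Ψ x (E4.basisVector 0) (E4.basisVector (I ()))

/-- The chart `Ψ` is in **wave-time gauge on `V ⊆ E4`**: its time covector `(∂₀)♭` solves the
tensorial wave equation `□_g (∂₀)♭ = 0` on `V` (rough d'Alembertian `MetricCoord.tlap` of the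
chart metric in the standard basis). Then `π = deform (∂₀)♭ = 𝓛_{∂₀} g` solves
`□π = −2 Riem·π` in vacuum (`MetricCoord.IsMetricOn.tlap_deform_eq_of_tlap_eq_zero`), and a
Killing `∂₀` is in this gauge (`□ξ = −Ric·ξ = 0`). Fischer–Marsden–Moncrief 1980, Lemma 2.2;
Moncrief 1975, §III. [cite: FischerMarsdenMoncrief1980, Lemma 2.2] -/
def IsWaveTimeOn (Ψ : B.domain → 𝓢.carrier) (V : Set E4) : Prop :=
  ∀ x ∈ V, ∀ I, MetricCoord.tlap (𝓢.chartMetricExtend B Ψ)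
    (EuclideanSpace.basisFun (Fin 4) ℝ).toBasis (𝓢.timeCovector B Ψ) x I = 0

/-- The **LE size of the stationarity defect** over the chart-time set `I` and the spatial zone
`Z ⊆ E4`: `∫_{timeBand I ∩ Z} (1+‖y‖)⁻² Σ_{m ≤ k} ‖D^m ∂₀(Ψ^* g)(x)‖² dx` (Lebesgue integral on
`E4`; in Kerr–Schild Cartesian coordinates `dVol = dt* dy = dτ dy`). The local-energy norm
`‖∂^{≤k} ·‖_{LE}` of Lindblad–Tohaneanu arXiv:2004.05664, (1.6)–(1.8) (`δ = 1`), applied to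
`𝓛_{∂₀} g`. [cite: LindbladTohaneanu2020, (1.6)–(1.8)] -/
def defectLE (Ψ : B.domain → 𝓢.carrier) (k : ℕ) (I : Set ℝ) (Z : Set E4) : ℝ≥0∞ :=
  ∫⁻ x in (Subtype.val '' B.timeBand I) ∩ Z, leSqDensity k (𝓢.chartMetricDt B Ψ) x

variable {𝓢 B}

/-- `defectLE` is monotone in the time set. [folklore] -/
theorem defectLE_mono_time (Ψ : B.domain → 𝓢.carrier) (k : ℕ) {I J : Set ℝ} (h : I ⊆ J)
    (Z : Set E4) : 𝓢.defectLE B Ψ k I Z ≤ 𝓢.defectLE B Ψ k J Z :=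
  lintegral_mono_set (inter_subset_inter_left _ (image_mono (B.timeBand_mono h)))

/-- `defectLE` is monotone in the zone. [folklore] -/
theorem defectLE_mono_zone (Ψ : B.domain → 𝓢.carrier) (k : ℕ) (I : Set ℝ) {Z W : Set E4}
    (h : Z ⊆ W) : 𝓢.defectLE B Ψ k I Z ≤ 𝓢.defectLE B Ψ k I W :=
  lintegral_mono_set (inter_subset_inter_right _ h)

/-- `defectLE` is monotone in the order. [folklore] -/
theorem defectLE_mono_order (Ψ : B.domain → 𝓢.carrier) {k k' : ℕ} (h : k ≤ k') (I : Set ℝ)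
    (Z : Set E4) : 𝓢.defectLE B Ψ k I Z ≤ 𝓢.defectLE B Ψ k' I Z :=
  lintegral_mono fun x ↦ leSqDensity_mono_right h _ x

variable (𝓢)

/-! ### Re-chartings and the LE-weighted leaf deviation -/

/-- `Φ`, a map from the hyperboloidal Kerr-star region `B♯(M, a)`, is an admissible
**re-charting of the unit band `Ψ({τ ≤ time ≤ τ+1})`** of the reference chart `Ψ` (modelled on
`B♯(M₀, a₀)`): `Φ` is smooth with smooth chart-metric components on its domain, injective on the
measured set `Φ⁻¹(Ψ(band))`, and its image covers the part of the band outside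
`r(a₀,·) ≥ (r₊(M₀,a₀) + M₀)/2` (the deep shell below, inside the black hole, need not be
re-charted). No regularity cap is imposed (near-isometries between bounded-geometry metrics are as
regular as the metrics). DHRT arXiv:2104.08222, §1 (closeness "in an appropriate gauge");
Klainerman–Szeftel, PAMQ 19 (2023), Thm. 1.1. [cite: arXiv210408222, §1] -/
structure IsLeafRechart (M₀ a₀ : ℝ) (Ψ : (Kerr.hypStarBackground M₀ a₀).domain → 𝓢.carrier)
    (τ M a : ℝ) (Φ : (Kerr.hypStarBackground M a).domain → 𝓢.carrier) : Prop where
  /-- `Φ` is smooth. -/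
  contMDiff : ContMDiff 𝓘(ℝ, E4) (𝓡 4) ∞ Φ
  /-- The components `Φ^* g` are smooth on the (open) domain. -/
  contDiffOn : ContDiffOn ℝ ∞ (𝓢.chartMetricExtend (Kerr.hypStarBackground M a) Φ)
    ((Kerr.hypStarBackground M a).domain : Set E4)
  /-- `Φ` is injective on the measured set `Φ⁻¹(Ψ(band))`. -/
  injOn : InjOn Φ (Φ ⁻¹' (Ψ '' (Kerr.hypStarBackground M₀ a₀).timeBand (Icc τ (τ + 1))))
  /-- `Φ` covers the band outside the deep shell. -/
  covers : Ψ '' ((Kerr.hypStarBackground M₀ a₀).timeBand (Icc τ (τ + 1)) ∩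
      {x | (Kerr.rPlus M₀ a₀ + M₀) / 2 ≤ Kerr.radius a₀ x.1}) ⊆ range Φ

/-- The **LE-weighted `Cᵏ` leaf deviation** `d_k(τ)` of the unit band `Ψ({τ ≤ time ≤ τ+1})`
from the sub-extremal Kerr family with spin margin `χ`: the infimum, over masses `M > 0`, spins
`|a| ≤ χ M` and admissible re-chartings `Φ` of the band (`IsLeafRechart`), of the LE-weighted
`Cᵏ` sup over the measured set `Φ⁻¹(Ψ(band))` of the deviation `Φ^* g − g_{M,a}`
(`deviationExtend`); `= ∞` if no re-charting exists, `= 0` on a Kerr region in any gauge. The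
gauge-invariant, parameter-fitted, LE-weighted version of `deviationCk` (DHRT arXiv:2104.08222,
§1) measuring `κ`-type integrated closeness (Lindblad–Tohaneanu arXiv:2004.05664, Thm. 1).
[cite: arXiv210408222, §1] [cite: LindbladTohaneanu2020, Thm. 1] -/
def leafDev (M₀ a₀ : ℝ) (Ψ : (Kerr.hypStarBackground M₀ a₀).domain → 𝓢.carrier) (χ : ℝ) (k : ℕ)
    (τ : ℝ) : ℝ≥0∞ :=
  ⨅ (M : ℝ) (a : ℝ) (_ : 0 < M ∧ |a| ≤ χ * M)
    (Φ : (Kerr.hypStarBackground M a).domain → 𝓢.carrier) (_ : 𝓢.IsLeafRechart M₀ a₀ Ψ τ M a Φ),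
    leSupCkENorm (Subtype.val '' (Φ ⁻¹' (Ψ '' (Kerr.hypStarBackground M₀ a₀).timeBand
      (Icc τ (τ + 1))))) k (𝓢.deviationExtend (Kerr.hypStarBackground M a) Φ)

variable {𝓢}

/-- The leaf deviation is monotone in the order `k`. [folklore] -/
theorem leafDev_mono_right (M₀ a₀ : ℝ) (Ψ : (Kerr.hypStarBackground M₀ a₀).domain → 𝓢.carrier)
    (χ : ℝ) {k k' : ℕ} (h : k ≤ k') (τ : ℝ) :
    𝓢.leafDev M₀ a₀ Ψ χ k τ ≤ 𝓢.leafDev M₀ a₀ Ψ χ k' τ :=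
  iInf_mono fun _ ↦ iInf_mono fun _ ↦ iInf_mono fun _ ↦ iInf_mono fun _ ↦ iInf_mono fun _ ↦
    leSupCkENorm_mono_right _ h _

/-- A re-charting with parameters in range bounds the leaf deviation from above. [folklore] -/
theorem leafDev_le (M₀ a₀ : ℝ) (Ψ : (Kerr.hypStarBackground M₀ a₀).domain → 𝓢.carrier)
    (χ : ℝ) (k : ℕ) (τ : ℝ) {M a : ℝ} (hM : 0 < M) (ha : |a| ≤ χ * M)
    {Φ : (Kerr.hypStarBackground M a).domain → 𝓢.carrier} (hΦ : 𝓢.IsLeafRechart M₀ a₀ Ψ τ M a Φ) :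
    𝓢.leafDev M₀ a₀ Ψ χ k τ ≤ leSupCkENorm (Subtype.val '' (Φ ⁻¹' (Ψ ''
      (Kerr.hypStarBackground M₀ a₀).timeBand (Icc τ (τ + 1))))) k
      (𝓢.deviationExtend (Kerr.hypStarBackground M a) Φ) :=
  (iInf_le _ M).trans <| (iInf_le _ a).trans <| (iInf_le _ (⟨hM, ha⟩ : 0 < M ∧ |a| ≤ χ * M)).trans <|
    (iInf_le _ Φ).trans (iInf_le _ hΦ)

variable (𝓢)

/-! ### The foliation hypothesis structure -/

/-- **Hyperboloidal Kerr-star foliation of order `k` with bounds `Λ`** (HYPOTHESIS structure —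
an assumption on a chart, never a conclusion of this tree): `Ψ` is a late chart after chart time
`τ₀` on the hyperboloidal Kerr-star background `B♯(M₀, a₀)`, `0 < M₀`, `|a₀| ≤ χ M₀`, `0 ≤ χ < 1`,
such that: the chart metric `Ψ^* g` is a genuine (smooth, symmetric, invertible) metric on the
late region (`MetricCoord.IsMetricOn`); its components have `C^{k+4}` bounds `Λ` on every unit
band `{τ ≤ time ≤ τ+1}`, `τ ≥ τ₀`, and its inverse components are bounded by `Λ` on the late
region (Anderson 2004, Def. 2.1, §5 (5.3)–(5.6): bounded geometry in a chart); the chart is in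
WAVE-TIME GAUGE `□_g(∂₀)♭ = 0` on the late region (Fischer–Marsden–Moncrief 1980, Lemma 2.2);
the time vector `∂₀` is future-directed in the far zone `{‖y‖ ≥ 8M₀}` (increasing chart time is
the `g`-future; `∂_{t*}` is spacelike in the ergoregion, so no sign is asked there); and the deep
shell `{r(a₀,·) ≤ (r₊+M₀)/2}` of the late region does not lie in the causal past of the far zone
(it is inside the black hole). Lindblad–Tohaneanu arXiv:2004.05664, §1 (the class of metrics
`g` close to Kerr on which Thm. 1 is stated); Anderson 2004, §5.
[cite: LindbladTohaneanu2020, §1] [cite: Anderson2004, Def. 2.1 and §5 (5.3)–(5.6)] -/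
structure IsHypKerrFoliation (k : ℕ) (Λ χ M₀ a₀ τ₀ : ℝ)
    (Ψ : (Kerr.hypStarBackground M₀ a₀).domain → 𝓢.carrier) : Prop where
  /-- The bound is positive. -/
  pos : 0 < Λ
  /-- The spin margin is a genuine sub-extremality margin. -/
  margin : 0 ≤ χ ∧ χ < 1
  /-- The reference mass is positive. -/
  mass_pos : 0 < M₀
  /-- The reference spin is within the margin. -/
  spin_le : |a₀| ≤ χ * M₀
  /-- `Ψ` is a late chart (smooth; an open embedding of the late region). -/
  lateChart : 𝓢.IsLateChart (Kerr.hypStarBackground M₀ a₀) univ τ₀ Ψ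
  /-- The chart metric is a genuine metric on the late region. -/
  isMetricOn : MetricCoord.IsMetricOn (𝓢.chartMetricExtend (Kerr.hypStarBackground M₀ a₀) Ψ)
    (Subtype.val '' (Kerr.hypStarBackground M₀ a₀).lateRegion τ₀)
  /-- `C^{k+4}` bounds `Λ` of the chart metric on every late unit band. -/
  ckBound : ∀ τ, τ₀ ≤ τ → 𝓢.chartMetricCk (Kerr.hypStarBackground M₀ a₀) Ψ (k + 4)
    ((Kerr.hypStarBackground M₀ a₀).timeBand (Icc τ (τ + 1))) ≤ ENNReal.ofReal Λ
  /-- The inverse components `g^{ij}` are bounded by `Λ` on the late region. -/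
  ginvBound : ∀ x ∈ Subtype.val '' (Kerr.hypStarBackground M₀ a₀).lateRegion τ₀, ∀ i j,
    |MetricCoord.ginv (𝓢.chartMetricExtend (Kerr.hypStarBackground M₀ a₀) Ψ)
      (EuclideanSpace.basisFun (Fin 4) ℝ).toBasis x i j| ≤ Λ
  /-- Wave-time gauge `□_g (∂₀)♭ = 0` on the late region. -/
  waveTime : 𝓢.IsWaveTimeOn (Kerr.hypStarBackground M₀ a₀) Ψ
    (Subtype.val '' (Kerr.hypStarBackground M₀ a₀).lateRegion τ₀)
  /-- `∂₀` is future-directed in the far zone of the late region. -/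
  futureFar : ∀ x ∈ (Kerr.hypStarBackground M₀ a₀).lateRegion τ₀, 8 * M₀ ≤ ‖E4.spatial x.1‖ →
    𝓢.timeOrientation.IsFutureDirected (mfderiv 𝓘(ℝ, E4) (𝓡 4) Ψ x (E4.basisVector 0))
  /-- The deep shell of the late region is not in the causal past of the far zone. -/
  deepShell : Ψ '' ((Kerr.hypStarBackground M₀ a₀).lateRegion τ₀ ∩
      {x | Kerr.radius a₀ x.1 ≤ (Kerr.rPlus M₀ a₀ + M₀) / 2}) ∩
    𝓢.metric.causalPast 𝓢.timeOrientation (Ψ '' ((Kerr.hypStarBackground M₀ a₀).lateRegion τ₀ ∩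
      {x | 8 * M₀ ≤ ‖E4.spatial x.1‖})) = ∅

variable {𝓢}

/-- A foliation of order `k'` is one of every lower order `k ≤ k'` (the `C^{k+4}` bound weakens).
[folklore] -/
theorem IsHypKerrFoliation.of_le {k k' : ℕ} (h : k ≤ k') {Λ χ M₀ a₀ τ₀ : ℝ}
    {Ψ : (Kerr.hypStarBackground M₀ a₀).domain → 𝓢.carrier}
    (hΨ : 𝓢.IsHypKerrFoliation k' Λ χ M₀ a₀ τ₀ Ψ) : 𝓢.IsHypKerrFoliation k Λ χ M₀ a₀ τ₀ Ψ where
  pos := hΨ.pos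
  margin := hΨ.margin
  mass_pos := hΨ.mass_pos
  spin_le := hΨ.spin_le
  lateChart := hΨ.lateChart
  isMetricOn := hΨ.isMetricOn
  ckBound τ hτ := (𝓢.chartMetricCk_mono_right _ _ (by omega) _).trans (hΨ.ckBound τ hτ)
  ginvBound := hΨ.ginvBound
  waveTime := hΨ.waveTime
  futureFar := hΨ.futureFar
  deepShell := hΨ.deepShell

end Spacetime

end Literature.Geometry.Lorentzian

end
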